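import Mathlib
import HarnessLib
import Literature.Analysis.FluidPDE.SuitableWeak
import Summits.NavierStokesRegularity.NavierStokesRegularity.Theses.AdiabaticEddy
import Summits.NavierStokesRegularity.NavierStokesRegularity.Theses.TypeILiouville
import Summits.NavierStokesRegularity.NavierStokesRegularity.Theses.Blowup

/-!
# `FrozenEddyCollapse` is a Type-II scenario (crux stmt-NavierStokesRegularity-1430)

Route AdiabaticEddy, crux `FrozenEddyCollapse`: a maximal classical Leray–Hopf solution which,
renormalised with amplitude `(T - t)^α`, `α ∈ (1/2, 3/4)`, around a centre path converges locally
uniformly to a nonzero profile `U`.  The docstring of the crux lists as a *consequence* that the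
blow-up is of Type II.  This file proves that consequence and turns it into two checked links:

* `not_isTypeIBlowup_of_tendsto_rescaled` — the analytic core: if `(T - t)^α • u t (x t) → v ≠ 0`
  as `t ↑ T` for some `α > 1/2` and some moving point `x t`, then `u` does not blow up at the Type-I
  rate `‖u(t, ·)‖ ≤ C / √(T - t)` (`Literature.Analysis.FluidPDE.IsTypeIBlowup`): along `x t` one has
  `‖u t (x t)‖ ≳ (T - t)^{-α} ≫ (T - t)^{-1/2}`.
* `frozenEddyCollapse_not_typeI` — every witness of `FrozenEddyCollapse` is a maximal smooth
  Leray–Hopf solution from a rapidly decaying datum which is NOT Type I at its lifespan.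
* `not_frozenEddyCollapse_of_noTypeII` — hence the crux `TypeIliouvilleNoTypeII` of route
  TypeILiouville (stmt-NavierStokesRegularity-0056: every such maximal solution is Type I) refutes
  `FrozenEddyCollapse`: the frozen-eddy collapse is a named sub-case of Type II.
* `not_frozenEddyCollapse_of_noFrozenEddyCollapse` — the route's own kill item
  `NoFrozenEddyCollapse` (stmt-NavierStokesRegularity-1431) refutes the crux (formal projection).
* `not_frozenEddyCollapse_of_noBlowup` — so does `TypeIliouvilleThesis` (= NoBlowup,
  stmt-NavierStokesRegularity-0054), directly through maximality (no uniqueness needed).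
* `blowupExists_of_frozenEddyCollapse` — projection to route Blowup's crux `BlowupExists` (X5a,
  stmt-NavierStokesRegularity-0152).
-/

noncomputable section

-- the summit-side namespace repeats a component by design (D-0017)
set_option linter.dupNamespace false

namespace Summit.NavierStokesRegularity.NavierStokesRegularity.Theorems

open Filter Topology Set
open Literature.Analysis.FluidPDE

local notation "ℝ³" => EuclideanSpace ℝ (Fin 3)

/-- **A super-Leray amplitude along a moving point excludes the Type-I rate.** If for some
`α > 1/2`, some moving point `x t` and some `v ≠ 0` one has `(T - t)^α • u t (x t) → v` as `t ↑ T`,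
then `¬ IsTypeIBlowup u T`: eventually `‖v‖/2 < (T-t)^α ‖u t (x t)‖ ≤ |C| (T-t)^{α-1/2} → 0`.
[folklore] -/
theorem not_isTypeIBlowup_of_tendsto_rescaled {E : Type*} [NormedAddCommGroup E] [NormedSpace ℝ E]
    {T α : ℝ} (hα : 1 / 2 < α) {u : ℝ → E → E} {x : ℝ → E} {v : E} (hv : v ≠ 0)
    (h : Tendsto (fun t => ((T - t) ^ α) • u t (x t)) (𝓝[<] T) (𝓝 v)) :
    ¬ IsTypeIBlowup u T := by
  rintro ⟨C, hC⟩
  have hvpos : 0 < ‖v‖ := norm_pos_iff.2 hv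
  have hev1 : ∀ᶠ t in 𝓝[<] T, ‖v‖ / 2 < ‖((T - t) ^ α) • u t (x t)‖ :=
    h.norm.eventually (lt_mem_nhds (by linarith))
  have hev2 : ∀ᶠ t in 𝓝[<] T, t ∈ Iio T := eventually_mem_nhdsWithin
  have hsub : Tendsto (fun t : ℝ => T - t) (𝓝[<] T) (𝓝 0) := by
    have hc : Tendsto (fun t : ℝ => T - t) (𝓝 T) (𝓝 (T - T)) :=
      (continuous_const.sub continuous_id).tendsto T
    rw [sub_self] at hc
    exact hc.mono_left nhdsWithin_le_nhds
  have hpow : Tendsto (fun t : ℝ => |C| * (T - t) ^ (α - 1 / 2)) (𝓝[<] T) (𝓝 0) := by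
    have hq : 0 < α - 1 / 2 := by linarith
    have hc0 : ContinuousAt (fun s : ℝ => s ^ (α - 1 / 2)) 0 :=
      Real.continuousAt_rpow_const 0 (α - 1 / 2) (Or.inr hq.le)
    have h0 : Tendsto (fun t : ℝ => (T - t) ^ (α - 1 / 2)) (𝓝[<] T) (𝓝 ((0 : ℝ) ^ (α - 1 / 2))) :=
      hc0.tendsto.comp hsub
    rw [Real.zero_rpow hq.ne'] at h0
    simpa using h0.const_mul |C|
  have hev3 : ∀ᶠ t in 𝓝[<] T, |C| * (T - t) ^ (α - 1 / 2) < ‖v‖ / 2 :=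
    hpow.eventually (gt_mem_nhds (by linarith))
  obtain ⟨t, h1, h2, h3, h4⟩ := (hev1.and (hev2.and (hev3.and hC))).exists
  have hTt : 0 < T - t := sub_pos.2 h2
  have hrpow_nonneg : 0 ≤ (T - t) ^ α := Real.rpow_nonneg hTt.le α
  have hnorm : ‖((T - t) ^ α) • u t (x t)‖ = (T - t) ^ α * ‖u t (x t)‖ := by
    rw [norm_smul, Real.norm_eq_abs, abs_of_nonneg hrpow_nonneg]
  have hux : ‖u t (x t)‖ ≤ |C| / Real.sqrt (T - t) :=
    (h4 (x t)).trans (div_le_div_of_nonneg_right (le_abs_self C) (Real.sqrt_nonneg _))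
  have hsqrt : Real.sqrt (T - t) = (T - t) ^ (1 / 2 : ℝ) := Real.sqrt_eq_rpow (T - t)
  have hkey : (T - t) ^ α * (|C| / Real.sqrt (T - t)) = |C| * (T - t) ^ (α - 1 / 2) := by
    rw [hsqrt, Real.rpow_sub hTt]
    ring
  have : ‖v‖ / 2 < |C| * (T - t) ^ (α - 1 / 2) := by
    calc ‖v‖ / 2 < ‖((T - t) ^ α) • u t (x t)‖ := h1
      _ = (T - t) ^ α * ‖u t (x t)‖ := hnorm
      _ ≤ (T - t) ^ α * (|C| / Real.sqrt (T - t)) := mul_le_mul_of_nonneg_left hux hrpow_nonneg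
      _ = |C| * (T - t) ^ (α - 1 / 2) := hkey
  linarith

/-- **Locally uniform version.** If the renormalised field `(T - t)^α • u t (x t y)` converges
locally uniformly in `y` to a profile `U ≠ 0` as `t ↑ T`, with `α > 1/2`, then `¬ IsTypeIBlowup u T`
(apply the pointwise lemma at a point where `U ≠ 0`). [folklore] -/
theorem not_isTypeIBlowup_of_tendstoLocallyUniformly {E : Type*} [NormedAddCommGroup E]
    [NormedSpace ℝ E] {T α : ℝ} (hα : 1 / 2 < α)
    {u : ℝ → E → E} {x : ℝ → E → E} {U : E → E} (hU : U ≠ 0)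
    (h : TendstoLocallyUniformly (fun t y => ((T - t) ^ α) • u t (x t y)) U (𝓝[<] T)) :
    ¬ IsTypeIBlowup u T := by
  obtain ⟨y₀, hy₀⟩ := Function.ne_iff.1 hU
  exact not_isTypeIBlowup_of_tendsto_rescaled (x := fun t => x t y₀) hα hy₀
    (h.tendstoLocallyUniformlyOn.tendsto_at (Set.mem_univ y₀))

/-- **Every frozen-eddy collapse is a Type-II blow-up.** A witness of the crux
`AdiabaticEddy.FrozenEddyCollapse` (stmt-NavierStokesRegularity-1430) is a maximal smooth solution,
Leray–Hopf from a rapidly decaying datum, which is not Type I at its lifespan `T`: the amplitude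
`(T - t)^{-α}`, `α > 1/2`, seen along the centre path beats the self-similar rate. This is the
"consequence (not conjunct)" recorded in the crux's docstring, now checked. [folklore] -/
theorem frozenEddyCollapse_not_typeI
    (h : Summit.NavierStokesRegularity.NavierStokesRegularity.Theses.AdiabaticEddy.FrozenEddyCollapse) :
    ∃ ν : ℝ, 0 < ν ∧ ∃ T : ℝ, 0 < T ∧ ∃ (u : ℝ → ℝ³ → ℝ³) (p : ℝ → ℝ³ → ℝ),
      IsMaximalSmoothSolution ν 0 u p T ∧ IsLerayHopfOn T ν 0 (u 0) u ∧
        HasRapidSpatialDecay (u 0) ∧ ¬ IsTypeIBlowup u T := by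
  obtain ⟨ν, hν, T, hT, u, p, hmax, hLH, hdec, U, P, -, -, -, hU0, -, -, α, hα, ℓ, -, ξ, hconv⟩ := h
  exact ⟨ν, hν, T, hT, u, p, hmax, hLH, hdec,
    not_isTypeIBlowup_of_tendstoLocallyUniformly
      (x := fun t y => ξ t + (ℓ * Real.sqrt (ν * (T - t))) • y) hα.1 hU0 hconv⟩

/-- **`NoTypeII` kills the frozen-eddy collapse (cross-route link).** The crux
`TypeILiouville.TypeIliouvilleNoTypeII` (stmt-NavierStokesRegularity-0056: every maximal smooth
Leray–Hopf solution from a rapidly decaying datum blows up at the Type-I rate) refutes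
`AdiabaticEddy.FrozenEddyCollapse` (stmt-NavierStokesRegularity-1430); equivalently a frozen-eddy
witness would refute `NoTypeII`. [folklore] -/
theorem not_frozenEddyCollapse_of_noTypeII
    (hII : Summit.NavierStokesRegularity.NavierStokesRegularity.Theses.TypeILiouville.TypeIliouvilleNoTypeII) :
    ¬ Summit.NavierStokesRegularity.NavierStokesRegularity.Theses.AdiabaticEddy.FrozenEddyCollapse := by
  intro h
  obtain ⟨ν, hν, T, hT, u, p, hmax, hLH, hdec, hnot⟩ := frozenEddyCollapse_not_typeI h
  exact hnot (hII ν T hν hT u p hmax hLH hdec)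

/-- **The route's kill item refutes the crux (formal projection).** `NoFrozenEddyCollapse`
(stmt-NavierStokesRegularity-1431, stated for every classical solution on `[0, T)`, no maximality)
implies `¬ FrozenEddyCollapse` (stmt-NavierStokesRegularity-1430): project the maximal solution to
its classical part and feed the witness' profile data; the conclusion `U = 0` contradicts `U ≠ 0`.
[folklore] -/
theorem not_frozenEddyCollapse_of_noFrozenEddyCollapse
    (hK : Summit.NavierStokesRegularity.NavierStokesRegularity.Theses.AdiabaticEddy.NoFrozenEddyCollapse) :
    ¬ Summit.NavierStokesRegularity.NavierStokesRegularity.Theses.AdiabaticEddy.FrozenEddyCollapse := by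
  intro h
  obtain ⟨ν, hν, T, hT, u, p, hmax, hLH, hdec, U, P, hU, hP, hUc, hU0, hdiv, hEul, α, hα, ℓ, hℓ, ξ,
    hconv⟩ := h
  exact hU0 (hK ν hν T hT u p hmax.1 hLH hdec U P hU hP hUc hdiv hEul α hα ℓ hℓ ξ hconv)

/-- **A frozen-eddy witness refutes `NoBlowup` directly (no uniqueness needed).** The target of
route TypeILiouville, `TypeIliouvilleThesis` (stmt-NavierStokesRegularity-0054: every classical
Leray–Hopf solution from a rapidly decaying datum extends smoothly past `T`), is incompatible with
`FrozenEddyCollapse`, whose witness is maximal (`¬ HasSmoothExtensionPast`) — the projection to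
X5a, recorded so that the ledger sees the edge without going through `ClayUniqueness`. [folklore] -/
theorem not_frozenEddyCollapse_of_noBlowup
    (hNB : Summit.NavierStokesRegularity.NavierStokesRegularity.Theses.TypeILiouville.TypeIliouvilleThesis) :
    ¬ Summit.NavierStokesRegularity.NavierStokesRegularity.Theses.AdiabaticEddy.FrozenEddyCollapse := by
  intro h
  obtain ⟨ν, hν, T, hT, u, p, hmax, hLH, hdec, -⟩ := h
  exact hmax.2 (hNB ν T hν hT u p hmax.1 hLH hdec)

/-- **Projection to X5a.** A witness of `FrozenEddyCollapse` (stmt-NavierStokesRegularity-1430) is in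
particular a witness of route Blowup's crux `BlowupExists` (= X5a, stmt-NavierStokesRegularity-0152: a
maximal smooth Leray–Hopf solution from a rapidly decaying datum with finite lifespan) — its first
three conjuncts. [folklore] -/
theorem blowupExists_of_frozenEddyCollapse
    (h : Summit.NavierStokesRegularity.NavierStokesRegularity.Theses.AdiabaticEddy.FrozenEddyCollapse) :
    Summit.NavierStokesRegularity.NavierStokesRegularity.Theses.Blowup.BlowupExists := by
  obtain ⟨ν, hν, T, hT, u, p, hmax, hLH, hdec, -⟩ := h
  exact ⟨ν, hν, T, hT, u, p, hmax, hLH, hdec⟩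

end Summit.NavierStokesRegularity.NavierStokesRegularity.Theorems

end
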